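import Literature.AlgebraicGeometry.HodgeTheory.FermatHodgeConjectureAoki
import Literature.AlgebraicGeometry.HodgeTheory.FermatInductiveClaims
import Literature.AlgebraicGeometry.HodgeTheory.FermatHodgeCharactersPrimePow
import Literature.AlgebraicGeometry.HodgeTheory.HypersurfaceLefschetzUpper
import Literature.AlgebraicGeometry.HodgeTheory.FermatSurfaceNeronSeveriEigenlines
import HarnessLib

/-!
# The Hodge conjecture for Fermat varieties of prime-power degree: the proof of Aoki's Cor. 2-3, assembled

Family `hodge`, layer `Literature/AlgebraicGeometry/HodgeTheory`. Proof file for the named fact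
`Aoki1987_hodgeClasses_algebraic_fermat_primePow` (file `FermatHodgeConjectureAoki`; N. Aoki,
J. Math. Soc. Japan 39 (1987), Cor. 2-3, p. 388: "If `m` is a power of a prime number, then Hodge
conjecture for `Xⁿₘ` is true for all `n`. PROOF. This is an immediate consequence of Theorem 1-2,
Theorem 1-4, Theorem 2-1 and Remark 2-2."). Everything here is PROVED; no named fact and no
definition is introduced. The file proves the IMPLICATION from the printed ingredients to the fact,
on the tree's real carriers, with every ingredient the tree does not yet prove appearing either as
one of the tree's NAMED FACTS (hypotheses `(h : X)`, fed `X_holds` when discharged) or as an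
EXPLICIT HYPOTHESIS in the exact spelling of the sibling proof files of
`hodgeClasses_algebraic_fermat` (`FermatHodgeConjectureAssembly`, whose architecture is reused):

* (L) Lefschetz off the middle degree — named fact `Voisin2003_smoothHypersurface_algebraicClasses_eq_top`
  (now DISCHARGED in the tree: `Voisin2003_smoothHypersurface_algebraicClasses_eq_top_holds`, see the last section);
* (E) the eigenspace structure of `H²ᵖ(X²ᵖₘ(ℂ); ℂ)` — the hypotheses `hE2`, `hE0`, `hE4` of
  `mem_algebraicClasses_fermat_middle_of_eigenspaces` (Ran Prop. 1.7; not in the tree);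
* (A) **Thm. 1-2** (the arithmetic: for `m = pᵏ` the standard elements generate `𝔅ₘ` modulo `𝔇ₘ`) —
  PROVED, `FermatCharacter.IsHodgeMultiset.exists_std_decomposition` / `forall_of_primePow`
  (file `FermatHodgeCharactersPrimePow`);
* (G) **Thm. 1-4 (i), (ii)** and **Thm. 1-1** — named facts `Aoki1987_claim_juxtaposition`,
  `Aoki1987_claim_of_claim_juxtaposition_paired`, `Shioda_claim_paired` (file `FermatInductiveClaims`);
* (S) **Thm. 2-1** — named fact `Aoki1987_claim_pStandard` (claim(`σ_{p,a}`) for `p` odd, `(a, d) = 1`,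
  `d = m/p > 2`), together with
  (D) the DEGREE-RAISING pull-back: claim(`α'`) on `X^{2r}_{m/g}` implies claim(`g α'`) on
  `X^{2r}ₘ` (the finite `μ`-equivariant morphism `X^{2r}ₘ → X^{2r}_{m/g}`, `[xᵢ] ↦ [xᵢᵍ]`, pulls
  `V(α')` back onto `V(gα')` and algebraic cycles back to algebraic cycles — the step by which the
  standard elements `σ_{p,i}` with `(i, d) = g > 1`, which are `g · σ_{p,i/g}` of level `m/g`, are
  covered; implicit in "immediate consequence", and the reason why da Silva, arXiv:2101.04739
  Thm. 2.8, credits Aoki with `m = p²` only), an explicit hypothesis `hDeg`; and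
  (F) claim for every Hodge character of the Fermat SURFACE `X²_{2ᵏ}` (Remark 2-2's curves for the
  `2`-standard elements `(i, i+d, -2i, d)`; equivalently Lefschetz `(1,1)` on `X²ₘ`), an explicit
  hypothesis `hSurf`.

## Contents

* `Aoki1987_primePow_of_middle`, `Aoki1987_primePow_middle_of_fermatHypersurface`,
  `Aoki1987_primePow_of_eigenspaces` — the sibling reductions (`hodgeClasses_algebraic_fermat_of_middle`,
  `…_middle_of_fermatHypersurface`, `…_of_eigenspaces`) in the degree range `IsPrimePow m`: the fact
  from (L), (E) and `hB` (claim for every Hodge character of `X²ᵖ_{m}`, `m` a prime power).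
* `FermatCharacter.IsHodge.claim_of_primePow_of_claims` — **`hB` from the claim calculus**: (A) in
  closed-family form applied to `C(s) = "claim(β) for every character β with value multiset s"`, whose
  closure properties are exactly (G) and the standard claims.
* `FermatCharacter.std_descend`, `FermatCharacter.claim_std_of_claims` — **the standard claims from
  (S), (D), (F)**: for `p` odd a standard element `σ_{p,a}` of level `pᵏ` with `g = (⟨a⟩, d)` is
  entrywise `g ·` the standard element `σ_{p,a/g}` of level `pᵏ/g`, which has `(a/g, d/g) = 1` and
  `d/g > 2` (Thm. 2-1 applies), and `p = 2` lives on the Fermat surface.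
* `Aoki1987_primePow_of_claims`, `Aoki1987_primePow_of_pStandard` — **the assembled implications**:
  `(L) + (E) + (G) + standard claims ⟹ fact`, resp. `(L) + (E) + (G) + (S) + (D) + (F) ⟹ fact`.
* `hodgeConjectureFor_fermat_primePow_of_pStandard` — the same in the summit's spelling
  `HodgeConjectureFor n X`, adding the existence of Hodge models (`nonempty_hodgeModel`).
* `hodgeClasses_algebraic_fermat_of_claims_at` — the PER-DEGREE assembly (one degree `m`: (L) + (E)
  at `m` + claim for the Hodge characters of the `X²ᵖₘ` ⟹ the Hodge classes of every `Xⁿₘ` are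
  algebraic), the common form of the sibling reductions.
* `FermatCharacter.two_lt_of_le_two`, `FermatCharacter.IsHodge.claim_of_primePow_le_two_of_claims`,
  `Aoki1987_primePow_le_two_of_pStandard`, `hodgeConjectureFor_fermat_primePow_le_two_of_pStandard` —
  **degrees `p` and `p²`** (da Silva's Thm. 2.8, "If `m = p²`, the Hodge conjecture is true for `Xⁿₘ`
  for all `n`", credited to Aoki): here every standard element has `(a, d) = 1` and `p` is odd, so
  (D) and (F) drop out and the fact in these degrees follows from (L), (E), (G), (S) alone; (D) is
  genuinely needed from `k = 3` on (`σ_{3,3} = (3, 12, 21, 18)` on `X²₂₇` is not a juxtaposition of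
  `(a, 9) = 1` standard elements and pairs modulo pairs: its odd part is supported at `9, 18`).

* `Aoki1987_primePow_of_inputs`, `hodgeConjectureFor_fermat_primePow_of_inputs`,
  `Aoki1987_primePow_le_two_of_claimFacts`, `hodgeConjectureFor_fermat_primePow_le_two_of_claimFacts`,
  `hodgeClasses_algebraic_fermat_of_claims_at'` — **the same implications with the inputs the tree now
  supplies fed in**: (L) is DISCHARGED (`Voisin2003_smoothHypersurface_algebraicClasses_eq_top_holds`,
  file `HypersurfaceLefschetzUpper`), and (F) is the `m = 2ᵏ` case of the tree's named fact
  `AokiShioda1983_eigenline_le_neronSeveri` (Aoki–Shioda 1983 `(2.1)`: every Hodge eigenline of the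
  Fermat surface is algebraic; file `FermatSurfaceNeronSeveriEigenlines`). What remains explicit:
  (E) and (D); what remains a named fact: (G), (S) and (F).

## What is NOT here (the residual inputs, as they appear in the hypotheses)

(G), (S) are undischarged named facts of the tree, and so is (F) in the form
`AokiShioda1983_eigenline_le_neronSeveri`; (L) is discharged; (E), (D) are not in the tree (the
`μₘⁿ⁺²`-structure and Hodge types of `Hⁿ(Xⁿₘ)`; the pull-back functoriality of `V(α)` and of
algebraic classes along `Xₘ → X_{m/g}`).

## References

* [Aoki1987] N. Aoki, Some new algebraic cycles on Fermat varieties, J. Math. Soc. Japan 39 (1987)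
  385–396: Thm. 1-1, §1 pp. 386–387, Thm. 1-2, Thm. 1-4, Thm. 2-1, Rem. 2-2, Cor. 2-3 (p. 388) (text read).
* [Shioda1979PJA] T. Shioda, Proc. Japan Acad. 55A (1979) 111–114, §2 Thm. 1, §4.
* [Ran1980] Z. Ran, Compositio Math. 42 (1980), Prop. 1.7, Thm. 4.9.
* [daSilva2021HodgeFermat] G. da Silva Jr., arXiv:2101.04739, Thm. 2.8 (`m = p²`).
* [Deligne2000] P. Deligne, The Hodge conjecture (Clay, 2000), §1.
-/

noncomputable section

open CategoryTheory AlgebraicGeometry MvPolynomial Finset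

namespace Literature.AlgebraicGeometry.HodgeTheory

open Literature.AlgebraicGeometry.Motives Literature.AlgebraicTopology.SingularHomology

/-! ### The fact from Lefschetz and the middle degree on the standard model (prime-power degree range) -/

section Assembly

variable {n m : ℕ} {X : Motives.SchemeOver ℂ}

/-- **The prime-power fact from Lefschetz and its middle-degree case** (the analogue of
`hodgeClasses_algebraic_fermat_of_middle`): off the middle degree every class of `H²ᵖ(Xⁿₘ(ℂ); ℂ)` is
algebraic by the Lefschetz fact (`algebraicClasses_fermat_eq_top_of_two_mul_ne`, `m ≥ 1`); `p = 0` is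
`algebraicClasses_zero`; the middle degree `n = 2p`, `p > 0` is the hypothesis.
[cite: Shioda1979PJA, §2 (p. 112), the sentence preceding Thm. 1] [cite: Aoki1987, Cor. 2-3 (p. 388)] -/
theorem Aoki1987_primePow_of_middle
    (hL : Voisin2003_smoothHypersurface_algebraicClasses_eq_top)
    (hmid : ∀ ⦃p m : ℕ⦄ ⦃X : Motives.SchemeOver ℂ⦄, IsPrimePow m →
      Motives.IsFermatVariety (2 * p) m X → Motives.IsSmoothProjective (2 * p) X → 0 < p →
        ∀ c : complexBetti X (2 * p), IsRationalClass c → IsOfHodgeType (2 * p) X (2 * p) p p c →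
          c ∈ algebraicClasses X p) :
    Aoki1987_hodgeClasses_algebraic_fermat_primePow := by
  intro n m X hm hF hX p c hc hpp
  by_cases hp : 2 * p = n
  · subst hp
    rcases Nat.eq_zero_or_pos p with rfl | hp0
    · rw [algebraicClasses_zero]
      exact Submodule.mem_top
    · exact hmid hm hF hX hp0 c hc hpp
  · rw [algebraicClasses_fermat_eq_top_of_two_mul_ne hL hX hF hm.one_lt.le hp]
    exact Submodule.mem_top

/-- **Reduction of the middle degree to the standard model `V₊(Σ xᵢᵐ)`** (the analogue of
`hodgeClasses_algebraic_fermat_middle_of_fermatHypersurface`, same transport along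
`X ≅ V₊(Σ xᵢᵐ)`), in the degree range `IsPrimePow m`. [cite: Shioda1979PJA, §1 eq. (1)] [cite: Aoki1987, Cor. 2-3 (p. 388)] -/
theorem Aoki1987_primePow_middle_of_fermatHypersurface
    (h : ∀ ⦃p m : ℕ⦄, IsPrimePow m → 0 < p →
      ∀ c : complexBetti (fermatHypersurface (2 * p) m) (2 * p), IsRationalClass c →
        IsOfHodgeType (2 * p) (fermatHypersurface (2 * p) m) (2 * p) p p c →
          c ∈ algebraicClasses (fermatHypersurface (2 * p) m) p) :
    ∀ ⦃p m : ℕ⦄ ⦃X : Motives.SchemeOver ℂ⦄, IsPrimePow m →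
      Motives.IsFermatVariety (2 * p) m X → Motives.IsSmoothProjective (2 * p) X → 0 < p →
        ∀ c : complexBetti X (2 * p), IsRationalClass c →
          IsOfHodgeType (2 * p) X (2 * p) p p c → c ∈ algebraicClasses X p := by
  intro p m X hm hF hX hp c hc hpp
  have hm1 : 1 ≤ m := hm.one_lt.le
  have hX' : IsSmoothProjective (2 * p) (fermatHypersurface (2 * p) m) :=
    isSmoothProjective_fermatHypersurface (by omega) hm1
  let e : X ≅ fermatHypersurface (2 * p) m := hF.isoFermatHypersurface
  set c' : complexBetti (fermatHypersurface (2 * p) m) (2 * p) :=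
    singularCohomology.map ℂ ℂ (Motives.AlgPoints.mapContinuous (L := ℂ) e.inv) (2 * p) c with hc'
  have hc'rat : IsRationalClass c' := hc.map _
  have hc'pp : IsOfHodgeType (2 * p) (fermatHypersurface (2 * p) m) (2 * p) p p c' :=
    hpp.map_of_iso e.symm
  have hc'alg := h hm hp c' hc'rat hc'pp
  have := mem_algebraicClasses_map_of_iso hX' hX e hc'alg
  rwa [hc', show complexBetti.map e.hom (2 * p)
      (singularCohomology.map ℂ ℂ (Motives.AlgPoints.mapContinuous (L := ℂ) e.inv) (2 * p) c) = c from
    map_hom_map_inv_apply e (2 * p) c] at this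

/-- **The prime-power fact from Lefschetz and the four middle-degree inputs** (the analogue of
`hodgeClasses_algebraic_fermat_of_eigenspaces`): granted (L) and, for every `p > 0` and every prime
power `m`, the eigenspace inputs `hE2`, `hE0`, `hE4` and the algebraicity `hB` of `V(α)` for every
Hodge character `α` of `X²ᵖₘ`, the fact holds (`mem_algebraicClasses_fermat_middle_of_eigenspaces`).
[cite: Aoki1987, Cor. 2-3 (p. 388)] [cite: Ran1980, Thm. 4.9 and §1 Prop. 1.7] -/
theorem Aoki1987_primePow_of_eigenspaces
    (hLef : Voisin2003_smoothHypersurface_algebraicClasses_eq_top)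
    (h : ∀ ⦃p m : ℕ⦄, IsPrimePow m → 0 < p →
      (∀ α : Fin (2 * p + 2) → ZMod m, α ≠ 0 → (∃ i, α i = 0) → fermatEigenspace m α (2 * p) = ⊥) ∧
      (fermatEigenspace m (0 : Fin (2 * p + 2) → ZMod m) (2 * p) ≤
        LinearMap.range (complexBetti.map (SmoothHypersurface.hypersurfaceι (fermatPolynomial ℂ (2 * p) m)) (2 * p)).hom) ∧
      (∀ (A : HodgeModel (2 * p) (fermatHypersurface (2 * p) m)) (β : Fin (2 * p + 2) → ZMod m),
        (∀ i, β i ≠ 0) →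
        (∃ x ∈ fermatEigenspace m β (2 * p), x ≠ 0 ∧ A.pullback (2 * p) x ∈ A.hodgePQ (2 * p) p p) →
          2 * FermatCharacter.normSum β = m * (2 * p + 2)) ∧
      (∀ α : Fin (2 * p + 2) → ZMod m, FermatCharacter.IsHodge α →
        fermatEigenspace m α (2 * p) ≤ algebraicClasses (fermatHypersurface (2 * p) m) p)) :
    Aoki1987_hodgeClasses_algebraic_fermat_primePow := by
  refine Aoki1987_primePow_of_middle hLef
    (Aoki1987_primePow_middle_of_fermatHypersurface fun p m hm hp c hc hpp ↦ ?_)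
  haveI : NeZero m := ⟨hm.ne_zero⟩
  obtain ⟨hE2, hE0, hE4, hB⟩ := h hm hp
  exact mem_algebraicClasses_fermat_middle_of_eigenspaces hp hE2 hE0 hE4 hB c hc hpp

end Assembly

/-! ### `hB` from the claim calculus: Thm. 1-2 with Thm. 1-4 and Thm. 1-1 -/

section Claims

variable {m : ℕ}

/-- A multiset with `N` elements is the multiset of values of a function on `Fin N`. [folklore] -/
theorem exists_eq_univ_val_map_of_card {Y : Type*} (w : Multiset Y) {N : ℕ} (h : Multiset.card w = N) :
    ∃ γ : Fin N → Y, univ.val.map γ = w := by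
  obtain ⟨r, α, rfl⟩ := FermatCharacter.exists_eq_univ_val_map w
  rw [Multiset.card_map, Finset.card_val, Finset.card_univ, Fintype.card_fin] at h
  subst h
  exact ⟨α, rfl⟩

/-- The multiset of values of the pair character `(a, -a)` is `{a, -a}`. [folklore] -/
theorem univ_val_map_vecPair (a : ZMod m) :
    univ.val.map (![a, -a] : Fin 2 → ZMod m) = {a, -a} := by
  rw [Fin.univ_val_map, Multiset.insert_eq_cons]
  simp only [List.ofFn_succ, List.ofFn_zero, Matrix.cons_val_zero, Matrix.cons_val_succ,
    Matrix.cons_val_fin_one]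
  rfl

/-- A character of `X⁰ₘ` (two coordinates) with values `{a, -a}`, `a ≠ 0`, is zero-free and paired
(`δ ∈ 𝔇⁰ₘ`: the swap involution). [cite: Aoki1987, §1 p. 386 (definition of 𝔇ⁿₘ)] -/
theorem isPaired_of_univ_val_map_eq_pair {a : ZMod m} (ha : a ≠ 0) {β : Fin (2 * 0 + 2) → ZMod m}
    (hβ : univ.val.map β = {a, -a}) : (∀ i, β i ≠ 0) ∧ FermatCharacter.IsPaired β := by
  have hsum : β 0 + β 1 = 0 := by
    have h := congrArg Multiset.sum hβ
    rw [← Finset.sum_eq_multiset_sum univ β, Fin.sum_univ_two] at h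
    simpa using h
  have hmem : β 0 = a ∨ β 0 = -a := by
    have h : β 0 ∈ univ.val.map β := Multiset.mem_map_of_mem _ (Finset.mem_univ_val 0)
    rw [hβ] at h
    simpa using h
  have h0 : β 0 ≠ 0 := by
    rcases hmem with h | h
    · rw [h]; exact ha
    · rw [h, neg_ne_zero]; exact ha
  have h1 : β 1 = -β 0 := eq_neg_of_add_eq_zero_right hsum
  refine ⟨?_, Equiv.swap 0 1, ?_, ?_, ?_⟩
  · intro i
    fin_cases i
    · exact h0
    · show β 1 ≠ 0
      rw [h1, neg_ne_zero]
      exact h0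
  · intro i
    fin_cases i <;> decide
  · intro i
    exact Equiv.swap_apply_self _ _ _
  · intro i
    fin_cases i
    · show β (Equiv.swap 0 1 0) = -β 0
      rw [Equiv.swap_apply_left]
      exact h1
    · show β (Equiv.swap 0 1 1) = -β 1
      rw [Equiv.swap_apply_right, h1, neg_neg]

/-- **Claim(`α`) for every Hodge character of `X^{2r}_{pᵏ}` from the claim calculus** (the proof of
Cor. 2-3 modulo its geometric inputs). Granted Thm. 1-4 (i) (`Aoki1987_claim_juxtaposition`),
Thm. 1-4 (ii) (`Aoki1987_claim_of_claim_juxtaposition_paired`), Thm. 1-1 (`Shioda_claim_paired`)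
and claim(`σ`) for every character `σ` whose value multiset is a standard multiset `σ_{p,a}`,
`2 < d/(⟨a⟩, d)` (hypothesis `hStd`: Thm. 2-1 / Rem. 2-2, see `claim_std_of_claims`), claim(`α`)
holds for every `α ∈ 𝔅^{2r}_{pᵏ}`: apply Thm. 1-2 in closed-family form
(`FermatCharacter.forall_of_primePow`) to the family `C(s)` = "claim(β) for every character `β` with
value multiset `s`"; pairs are in `C` by Thm. 1-1, standard multisets by `hStd`, and `C` is closed
under juxtaposition and pair cancellation by Thm. 1-4 (re-indexing characters of prescribed value
multiset through `Fin (2r+2)`). [cite: Aoki1987, Cor. 2-3 (p. 388), proof, with Thm. 1-2 and Thm. 1-4] -/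
theorem FermatCharacter.IsHodge.claim_of_primePow_of_claims
    (hJ : Aoki1987_claim_juxtaposition) (hC : Aoki1987_claim_of_claim_juxtaposition_paired)
    (hP : Shioda_claim_paired) {p k : ℕ} (hp : p.Prime) (hk : 0 < k)
    (hStd : ∀ a : ZMod (p ^ k), 2 < (p ^ k / p) / Nat.gcd a.val (p ^ k / p) →
      ∀ (r : ℕ) (σ : Fin (2 * r + 2) → ZMod (p ^ k)),
        univ.val.map σ =
          (Multiset.range p).map (fun i : ℕ ↦ a + (i : ZMod (p ^ k)) * ((p ^ k / p : ℕ) : ZMod (p ^ k)))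
            + {-((p : ZMod (p ^ k)) * a)} + (if p = 2 then {((p ^ k / p : ℕ) : ZMod (p ^ k))} else 0) →
        FermatCharacter.Claim (p ^ k) r σ)
    {r : ℕ} {α : Fin (2 * r + 2) → ZMod (p ^ k)} (hα : FermatCharacter.IsHodge α) :
    FermatCharacter.Claim (p ^ k) r α := by
  classical
  haveI : NeZero (p ^ k) := ⟨pow_ne_zero _ hp.ne_zero⟩
  -- the family of multisets all of whose characters satisfy claim
  set C : Multiset (ZMod (p ^ k)) → Prop := fun s ↦ ∀ (r : ℕ) (β : Fin (2 * r + 2) → ZMod (p ^ k)),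
    univ.val.map β = s → FermatCharacter.Claim (p ^ k) r β with hCdef
  suffices H : ∀ s : Multiset (ZMod (p ^ k)), s ≠ 0 → FermatCharacter.IsHodgeMultiset s → C s by
    refine H (univ.val.map α) ?_ hα.isHodgeMultiset r α rfl
    intro h0
    have := congrArg Multiset.card h0
    rw [FermatCharacter.card_univ_val_map, Multiset.card_zero] at this
    omega
  refine FermatCharacter.forall_of_primePow hp hk (C := C) ?_ ?_ ?_ ?_
  · -- pairs `(a, -a)`: Thm. 1-1 (linear subspaces)
    intro a ha r β hβ
    have hr : r = 0 := by
      have := congrArg Multiset.card hβ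
      rw [FermatCharacter.card_univ_val_map, Multiset.insert_eq_cons, Multiset.card_cons,
        Multiset.card_singleton] at this
      omega
    subst hr
    obtain ⟨hne, hpaired⟩ := isPaired_of_univ_val_map_eq_pair ha hβ
    exact hP (p ^ k) 0 β hne hpaired
  · -- standard elements: Thm. 2-1 / Rem. 2-2 (hypothesis `hStd`)
    exact fun a ha r β hβ ↦ hStd a ha r β hβ
  · -- juxtaposition: Thm. 1-4 (i)
    intro t u ht0 hu0 ht hu hCt hCu n γ hγ
    obtain ⟨r, hr⟩ : ∃ r, Multiset.card t = 2 * r + 2 := by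
      obtain ⟨x, hx⟩ := ht.even_card
      have := ht.two_le_card ht0
      exact ⟨x - 1, by omega⟩
    obtain ⟨s, hs⟩ : ∃ s, Multiset.card u = 2 * s + 2 := by
      obtain ⟨x, hx⟩ := hu.even_card
      have := hu.two_le_card hu0
      exact ⟨x - 1, by omega⟩
    obtain ⟨α', hα'⟩ := exists_eq_univ_val_map_of_card t hr
    obtain ⟨β', hβ'⟩ := exists_eq_univ_val_map_of_card u hs
    have hn : n = r + s + 1 := by
      have := congrArg Multiset.card hγ
      rw [FermatCharacter.card_univ_val_map, Multiset.card_add, hr, hs] at this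
      omega
    subst hn
    refine hJ (p ^ k) r s α' β' γ ?_ ?_ (by rw [hγ, hα', hβ']) (hCt r α' hα') (hCu s β' hβ')
    · exact (FermatCharacter.isHodge_iff_isHodgeMultiset α').mpr (hα' ▸ ht)
    · exact (FermatCharacter.isHodge_iff_isHodgeMultiset β').mpr (hβ' ▸ hu)
  · -- cancellation of a pair: Thm. 1-4 (ii)
    intro s a hs0 hs ha hCs r α' hα'
    have hcard : Multiset.card (s + {a, -a}) = 2 * (r + 0 + 1) + 2 := by
      rw [Multiset.card_add, ← hα', FermatCharacter.card_univ_val_map, Multiset.insert_eq_cons,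
        Multiset.card_cons, Multiset.card_singleton]
      omega
    obtain ⟨γ, hγ⟩ := exists_eq_univ_val_map_of_card _ hcard
    set δ : Fin (2 * 0 + 2) → ZMod (p ^ k) := ![a, -a] with hδdef
    have hδ : univ.val.map δ = {a, -a} := univ_val_map_vecPair a
    obtain ⟨hne, hpaired⟩ := isPaired_of_univ_val_map_eq_pair ha hδ
    refine hC (p ^ k) r 0 α' δ γ ?_ hne hpaired (by rw [hγ, hα', hδ]) (hCs _ γ hγ)
    exact (FermatCharacter.isHodge_iff_isHodgeMultiset α').mpr (hα' ▸ hs)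

end Claims

/-! ### The standard claims from Thm. 2-1, the degree-raising pull-back and the Fermat surface -/

section Standard

namespace FermatCharacter

variable {p k : ℕ}

/-- **Descent of a standard element to level `pᵏ/(⟨a⟩, d)`** (`p` odd). Let `σ` be a character of
level `pᵏ` whose value multiset is the standard multiset `σ_{p,a}`, `2 < d/(⟨a⟩, d)`, and put
`g = (⟨a⟩, d)`, `M = pᵏ/g`. Then `p = 2r + 1` (cardinality), `p ∣ M`, `M/p = d/g > 2`, and
`σ = g · σ'` entrywise (`⟨σ i⟩ = g ⟨σ' i⟩`) for the character `σ' i = ⟨σ i⟩/g` of level `M`, which is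
zero-free and whose value multiset is the standard multiset `σ_{p,a'}` of level `M`, `a' = ⟨a⟩/g`,
with `(⟨a'⟩, M/p) = 1` — the hypotheses of Thm. 2-1 (`Aoki1987_claim_pStandard`) at level `M`.
(`⟨a + jd⟩ = g((a' + j d') mod M)`, `⟨-pa⟩ = g(M - (p a' mod M))`, `d' = d/g`.)
[cite: Aoki1987, §1 p. 387 (σ_{p,i}, d/(i,d) > 2) and Thm. 2-1 (p. 388)] -/
theorem std_descend (hp : p.Prime) (hk : 0 < k) (hp2 : p ≠ 2) {a : ZMod (p ^ k)}
    (ha : 2 < (p ^ k / p) / Nat.gcd a.val (p ^ k / p)) {r : ℕ} (σ : Fin (2 * r + 2) → ZMod (p ^ k))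
    (hσ : univ.val.map σ =
      (Multiset.range p).map (fun i : ℕ ↦ a + (i : ZMod (p ^ k)) * ((p ^ k / p : ℕ) : ZMod (p ^ k)))
        + {-((p : ZMod (p ^ k)) * a)} + (if p = 2 then {((p ^ k / p : ℕ) : ZMod (p ^ k))} else 0)) :
    ∃ (a' : ZMod (p ^ k / Nat.gcd a.val (p ^ k / p)))
      (σ' : Fin (2 * r + 2) → ZMod (p ^ k / Nat.gcd a.val (p ^ k / p))),
      p = 2 * r + 1 ∧ 0 < Nat.gcd a.val (p ^ k / p) ∧ Nat.gcd a.val (p ^ k / p) ∣ p ^ k ∧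
      p ∣ p ^ k / Nat.gcd a.val (p ^ k / p) ∧
      2 < p ^ k / Nat.gcd a.val (p ^ k / p) / p ∧
      Nat.Coprime a'.val (p ^ k / Nat.gcd a.val (p ^ k / p) / p) ∧
      (∀ i, σ' i ≠ 0) ∧
      (∀ i, σ i = ((Nat.gcd a.val (p ^ k / p) * (σ' i).val : ℕ) : ZMod (p ^ k))) ∧
      univ.val.map σ' =
        (Multiset.range p).map (fun i : ℕ ↦ a' + (i : ZMod (p ^ k / Nat.gcd a.val (p ^ k / p))) *
            ((p ^ k / Nat.gcd a.val (p ^ k / p) / p : ℕ) : ZMod (p ^ k / Nat.gcd a.val (p ^ k / p))))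
          + {-((p : ZMod (p ^ k / Nat.gcd a.val (p ^ k / p))) * a')} := by
  classical
  haveI : NeZero (p ^ k) := ⟨pow_ne_zero _ hp.ne_zero⟩
  -- notation: `P = p^k`, `d = P/p`, `g = (⟨a⟩, d)`, `M = P/g`, `a₀ = ⟨a⟩/g`, `d' = d/g`
  set d : ℕ := p ^ k / p with hd
  set g : ℕ := Nat.gcd a.val d with hg
  have hpd : p * d = p ^ k := Nat.mul_div_cancel' (dvd_pow_self p hk.ne')
  have hd0 : 0 < d := Nat.pos_of_ne_zero fun h ↦ NeZero.ne (p ^ k) (by rw [← hpd, h, mul_zero])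
  have hg0 : 0 < g := Nat.gcd_pos_of_pos_right _ hd0
  have hgd : g ∣ d := Nat.gcd_dvd_right _ _
  have hga : g ∣ a.val := Nat.gcd_dvd_left _ _
  obtain ⟨d', hd'⟩ := hgd
  obtain ⟨a₀, ha₀⟩ := hga
  have hd'eq : d / g = d' := by rw [hd', Nat.mul_div_cancel_left _ hg0]
  have ha₀eq : a.val / g = a₀ := by rw [ha₀, Nat.mul_div_cancel_left _ hg0]
  have hgP : g ∣ p ^ k := ⟨p * d', by rw [← hpd, hd']; ring⟩
  set M : ℕ := p ^ k / g with hM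
  have hMg : g * M = p ^ k := Nat.mul_div_cancel' hgP
  have hMeq : M = p * d' := by
    apply Nat.eq_of_mul_eq_mul_left hg0
    rw [hMg, ← hpd, hd']
    ring
  have hM0 : 0 < M := by rw [hMeq]; exact Nat.mul_pos hp.pos (by
    rcases Nat.eq_zero_or_pos d' with h | h
    · rw [h, mul_zero] at hd'; omega
    · exact h)
  haveI : NeZero M := ⟨hM0.ne'⟩
  have hpM : p ∣ M := ⟨d', hMeq⟩
  have hMp : M / p = d' := by rw [hMeq, Nat.mul_div_cancel_left _ hp.pos]
  have h2d' : 2 < d' := by rw [← hd'eq]; exact ha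
  -- `p a ≠ 0`, and `p` is odd: `p = 2r + 1`
  have hpa : (p : ZMod (p ^ k)) * a ≠ 0 := p_mul_ne_zero_of_two_lt hp hk ha
  have hcard : p = 2 * r + 1 := by
    have h := congrArg Multiset.card hσ
    rw [card_univ_val_map, if_neg hp2, add_zero, Multiset.card_add, Multiset.card_map,
      Multiset.card_range, Multiset.card_singleton] at h
    omega
  -- the representatives of the entries of `σ` are multiples of `g`
  have hval_prog : ∀ i : ℕ, (a + (i : ZMod (p ^ k)) * (d : ZMod (p ^ k))).val = g * ((a₀ + i * d') % M) := by
    intro i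
    have e1 : a + (i : ZMod (p ^ k)) * (d : ZMod (p ^ k)) = ((a.val + i * d : ℕ) : ZMod (p ^ k)) := by
      push_cast
      rw [ZMod.natCast_zmod_val]
    rw [e1, ZMod.val_natCast, ha₀, hd', show g * a₀ + i * (g * d') = g * (a₀ + i * d') by ring, ← hMg,
      Nat.mul_mod_mul_left]
  have hpa_val : ((p : ZMod (p ^ k)) * a).val = g * ((p * a₀) % M) := by
    have e1 : (p : ZMod (p ^ k)) * a = ((p * a.val : ℕ) : ZMod (p ^ k)) := by
      rw [Nat.cast_mul, ZMod.natCast_zmod_val]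
    rw [e1, ZMod.val_natCast, ha₀, show p * (g * a₀) = g * (p * a₀) by ring, ← hMg, Nat.mul_mod_mul_left]
  have hpa₀ : (p * a₀) % M ≠ 0 := by
    intro h0
    apply hpa
    apply (ZMod.val_eq_zero _).mp
    rw [hpa_val, h0, mul_zero]
  have hneg_val : (-((p : ZMod (p ^ k)) * a)).val = g * (M - (p * a₀) % M) := by
    rw [ZMod.neg_val, if_neg hpa, hpa_val, ← hMg, Nat.mul_sub]
  -- the descended element and character
  set a' : ZMod M := ((a₀ : ℕ) : ZMod M) with ha'
  set φ : ZMod (p ^ k) → ZMod M := fun x ↦ ((x.val / g : ℕ) : ZMod M) with hφ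
  refine ⟨a', fun i ↦ φ (σ i), hcard, hg0, hgP, hpM, by rw [hMp]; exact h2d', ?_, ?_, ?_, ?_⟩
  · -- coprimality `(a₀, d') = 1`
    rw [hMp]
    have hlt : a₀ < M := by
      have : g * a₀ < g * M := by rw [← ha₀, hMg]; exact ZMod.val_lt a
      exact Nat.lt_of_mul_lt_mul_left this
    have hval : a'.val = a₀ := by rw [ha', ZMod.val_natCast, Nat.mod_eq_of_lt hlt]
    rw [hval, ← ha₀eq, ← hd'eq]
    exact Nat.coprime_div_gcd_div_gcd hg0
  · -- the descended entries are non-zero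
    intro i
    have hmem : σ i ∈ univ.val.map σ := Multiset.mem_map_of_mem _ (Finset.mem_univ_val i)
    rw [hσ, if_neg hp2, add_zero] at hmem
    simp only [hφ]
    intro h0
    rw [ZMod.natCast_eq_zero_iff] at h0
    -- `M ∣ ⟨σ i⟩ / g` with `⟨σ i⟩ / g < M` forces `⟨σ i⟩ / g = 0`, i.e. `⟨σ i⟩ < g`
    have hlt : (σ i).val / g < M := by
      apply Nat.div_lt_of_lt_mul
      rw [hMg]
      exact ZMod.val_lt _
    have hzero : (σ i).val / g = 0 := Nat.eq_zero_of_dvd_of_lt h0 hlt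
    rcases Multiset.mem_add.mp hmem with h | h
    · obtain ⟨j, -, hj⟩ := Multiset.mem_map.mp h
      rw [← hj, hval_prog j, Nat.mul_div_cancel_left _ hg0] at hzero
      -- `(a₀ + j d') % M = 0` contradicts `p ∤`... : then `g * 0 = ⟨a + j d⟩`, so `a + j d = 0`, so `p a = 0`
      apply hpa
      have hx0 : a + (j : ZMod (p ^ k)) * (d : ZMod (p ^ k)) = 0 := by
        apply (ZMod.val_eq_zero _).mp
        rw [hval_prog j, hzero, mul_zero]
      have : (p : ZMod (p ^ k)) * (a + (j : ZMod (p ^ k)) * (d : ZMod (p ^ k))) = (p : ZMod (p ^ k)) * a := by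
        rw [mul_add, mul_left_comm, ← Nat.cast_mul, hpd, ZMod.natCast_self, mul_zero, add_zero]
      rw [← this, hx0, mul_zero]
    · rw [Multiset.mem_singleton] at h
      rw [h, hneg_val, Nat.mul_div_cancel_left _ hg0] at hzero
      have := Nat.mod_lt (p * a₀) hM0
      omega
  · -- `σ i = g · ⟨σ' i⟩`
    intro i
    have hmem : σ i ∈ univ.val.map σ := Multiset.mem_map_of_mem _ (Finset.mem_univ_val i)
    rw [hσ, if_neg hp2, add_zero] at hmem
    have hdvd : g ∣ (σ i).val := by
      rcases Multiset.mem_add.mp hmem with h | h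
      · obtain ⟨j, -, hj⟩ := Multiset.mem_map.mp h
        rw [← hj, hval_prog j]
        exact dvd_mul_right _ _
      · rw [Multiset.mem_singleton] at h
        rw [h, hneg_val]
        exact dvd_mul_right _ _
    have hlt : (σ i).val / g < M := by
      apply Nat.div_lt_of_lt_mul
      rw [hMg]
      exact ZMod.val_lt _
    simp only [hφ]
    rw [ZMod.val_natCast, Nat.mod_eq_of_lt hlt, Nat.mul_div_cancel' hdvd, ZMod.natCast_zmod_val]
  · -- the multiset of values descends to the standard multiset of `a'` at level `M`
    have hcomp : univ.val.map (fun i ↦ φ (σ i)) = (univ.val.map σ).map φ := by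
      rw [Multiset.map_map]
      rfl
    rw [hcomp, hσ, if_neg hp2, add_zero, Multiset.map_add, Multiset.map_singleton, Multiset.map_map, hMp]
    congr 1
    · apply Multiset.map_congr rfl
      intro j _
      simp only [Function.comp_apply, hφ]
      rw [hval_prog j, Nat.mul_div_cancel_left _ hg0, ZMod.natCast_mod, ha']
      push_cast
      ring
    · simp only [hφ]
      rw [hneg_val, Nat.mul_div_cancel_left _ hg0]
      have hle : (p * a₀) % M ≤ M := (Nat.mod_lt _ hM0).le
      congr 1
      rw [Nat.cast_sub hle, ZMod.natCast_self, zero_sub, ZMod.natCast_mod, ha']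
      push_cast
      ring


/-- **The standard claims from Thm. 2-1, degree raising and the Fermat surface.** Granted
`Aoki1987_claim_pStandard` (Thm. 2-1: claim(`σ_{p,a}`) on `X^{p-1}ₘ` for `p` odd, `(a, d) = 1`,
`d > 2`), the degree-raising pull-back `hDeg` (claim(`α'`) at level `m/g` for a zero-free `α'` implies
claim of the character `g α'` of level `m` with `⟨(gα') i⟩ = g ⟨α' i⟩` — the finite morphism
`X^{2r}ₘ → X^{2r}_{m/g}`, `[xᵢ] ↦ [xᵢᵍ]`) and claim for every Hodge character of the Fermat surface
`X²_{2ᵏ}` (`hSurf`: Rem. 2-2 / Lefschetz `(1,1)`), claim holds for every character of level `pᵏ` whose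
value multiset is a standard multiset `σ_{p,a}` with `2 < d/(⟨a⟩, d)`: for `p = 2` it is a Hodge
character of `X²` (`isHodgeMultiset_std`); for `p` odd descend to level `pᵏ/(⟨a⟩,d)` (`std_descend`),
apply Thm. 2-1 there and raise the degree. [cite: Aoki1987, Thm. 2-1, Rem. 2-2 and Cor. 2-3 (p. 388)]
[cite: daSilva2021HodgeFermat, Thm. 2.8] -/
theorem claim_std_of_claims (hS : Aoki1987_claim_pStandard)
    (hDeg : ∀ (m g r : ℕ) (α' : Fin (2 * r + 2) → ZMod (m / g)) (α : Fin (2 * r + 2) → ZMod m),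
      0 < g → g ∣ m → (∀ i, α' i ≠ 0) → (∀ i, α i = ((g * (α' i).val : ℕ) : ZMod m)) →
      FermatCharacter.Claim (m / g) r α' → FermatCharacter.Claim m r α)
    (hSurf : ∀ (k : ℕ) (σ : Fin (2 * 1 + 2) → ZMod (2 ^ k)), FermatCharacter.IsHodge σ →
      FermatCharacter.Claim (2 ^ k) 1 σ)
    (hp : p.Prime) (hk : 0 < k) (a : ZMod (p ^ k))
    (ha : 2 < (p ^ k / p) / Nat.gcd a.val (p ^ k / p)) (r : ℕ) (σ : Fin (2 * r + 2) → ZMod (p ^ k))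
    (hσ : univ.val.map σ =
      (Multiset.range p).map (fun i : ℕ ↦ a + (i : ZMod (p ^ k)) * ((p ^ k / p : ℕ) : ZMod (p ^ k)))
        + {-((p : ZMod (p ^ k)) * a)} + (if p = 2 then {((p ^ k / p : ℕ) : ZMod (p ^ k))} else 0)) :
    FermatCharacter.Claim (p ^ k) r σ := by
  classical
  by_cases hp2 : p = 2
  · subst hp2
    have hpa := p_mul_ne_zero_of_two_lt hp hk ha
    have hH : IsHodge σ :=
      (isHodge_iff_isHodgeMultiset σ).mpr (hσ ▸ isHodgeMultiset_std hp hk hpa)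
    have hr : r = 1 := by
      have h := congrArg Multiset.card hσ
      rw [card_univ_val_map, if_pos rfl, Multiset.card_add, Multiset.card_add, Multiset.card_map,
        Multiset.card_range, Multiset.card_singleton, Multiset.card_singleton] at h
      omega
    subst hr
    exact hSurf k σ hH
  · obtain ⟨a', σ', hpr, hg0, hgP, hpM, h2, hcop, hne, hσσ', hσ'⟩ := std_descend hp hk hp2 ha σ hσ
    haveI : NeZero (p ^ k / Nat.gcd a.val (p ^ k / p)) :=
      ⟨fun h ↦ by rw [h, Nat.zero_div] at h2; omega⟩
    exact hDeg (p ^ k) _ r σ' σ hg0 hgP hne hσσ' (hS _ p r hp hpr hpM h2 a' hcop σ' hσ')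

end FermatCharacter

end Standard

/-! ### The assembled implications -/

section Final

/-- **Cor. 2-3 assembled, I: `Aoki1987_hodgeClasses_algebraic_fermat_primePow` from Lefschetz (L), the
eigenspace inputs (E), Thm. 1-4 (i)/(ii) and Thm. 1-1 (named facts), and the standard claims** (claim
for every character of prime-power level whose value multiset is a standard multiset — Thm. 2-1 /
Rem. 2-2 in the form `claim_std_of_claims` produces). Thm. 1-2 enters PROVED
(`FermatCharacter.forall_of_primePow`). [cite: Aoki1987, Cor. 2-3 (p. 388)] -/
theorem Aoki1987_primePow_of_claims
    (hLef : Voisin2003_smoothHypersurface_algebraicClasses_eq_top)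
    (hE : ∀ ⦃p m : ℕ⦄, IsPrimePow m → 0 < p →
      (∀ α : Fin (2 * p + 2) → ZMod m, α ≠ 0 → (∃ i, α i = 0) → fermatEigenspace m α (2 * p) = ⊥) ∧
      (fermatEigenspace m (0 : Fin (2 * p + 2) → ZMod m) (2 * p) ≤
        LinearMap.range (complexBetti.map (SmoothHypersurface.hypersurfaceι (fermatPolynomial ℂ (2 * p) m)) (2 * p)).hom) ∧
      (∀ (A : HodgeModel (2 * p) (fermatHypersurface (2 * p) m)) (β : Fin (2 * p + 2) → ZMod m),
        (∀ i, β i ≠ 0) →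
        (∃ x ∈ fermatEigenspace m β (2 * p), x ≠ 0 ∧ A.pullback (2 * p) x ∈ A.hodgePQ (2 * p) p p) →
          2 * FermatCharacter.normSum β = m * (2 * p + 2)))
    (hJ : Aoki1987_claim_juxtaposition) (hC : Aoki1987_claim_of_claim_juxtaposition_paired)
    (hP : Shioda_claim_paired)
    (hStd : ∀ (q k : ℕ), q.Prime → 0 < k → ∀ a : ZMod (q ^ k), 2 < (q ^ k / q) / Nat.gcd a.val (q ^ k / q) →
      ∀ (r : ℕ) (σ : Fin (2 * r + 2) → ZMod (q ^ k)),
        univ.val.map σ =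
          (Multiset.range q).map (fun i : ℕ ↦ a + (i : ZMod (q ^ k)) * ((q ^ k / q : ℕ) : ZMod (q ^ k)))
            + {-((q : ZMod (q ^ k)) * a)} + (if q = 2 then {((q ^ k / q : ℕ) : ZMod (q ^ k))} else 0) →
        FermatCharacter.Claim (q ^ k) r σ) :
    Aoki1987_hodgeClasses_algebraic_fermat_primePow := by
  refine Aoki1987_primePow_of_eigenspaces hLef fun p m hm hp ↦ ?_
  obtain ⟨hE2, hE0, hE4⟩ := hE hm hp
  refine ⟨hE2, hE0, hE4, fun α hα ↦ ?_⟩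
  obtain ⟨q, k, hq, hk, rfl⟩ := (isPrimePow_nat_iff m).mp hm
  exact hα.claim_of_primePow_of_claims hJ hC hP hq hk (hStd q k hq hk)

/-- **Cor. 2-3 assembled, II: the fact from (L), (E), the four named facts of `FermatInductiveClaims`
(Thm. 1-4 (i), (ii), Thm. 1-1, Thm. 2-1), the degree-raising pull-back (D) and the Fermat surfaces of
degree `2ᵏ` (F)** — the printed proof "Theorem 1-2, Theorem 1-4, Theorem 2-1 and Remark 2-2" with
its implicit steps made explicit; the exact residual obligations of the named fact.
[cite: Aoki1987, Cor. 2-3 (p. 388)] [cite: daSilva2021HodgeFermat, Thm. 2.8] -/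
theorem Aoki1987_primePow_of_pStandard
    (hLef : Voisin2003_smoothHypersurface_algebraicClasses_eq_top)
    (hE : ∀ ⦃p m : ℕ⦄, IsPrimePow m → 0 < p →
      (∀ α : Fin (2 * p + 2) → ZMod m, α ≠ 0 → (∃ i, α i = 0) → fermatEigenspace m α (2 * p) = ⊥) ∧
      (fermatEigenspace m (0 : Fin (2 * p + 2) → ZMod m) (2 * p) ≤
        LinearMap.range (complexBetti.map (SmoothHypersurface.hypersurfaceι (fermatPolynomial ℂ (2 * p) m)) (2 * p)).hom) ∧
      (∀ (A : HodgeModel (2 * p) (fermatHypersurface (2 * p) m)) (β : Fin (2 * p + 2) → ZMod m),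
        (∀ i, β i ≠ 0) →
        (∃ x ∈ fermatEigenspace m β (2 * p), x ≠ 0 ∧ A.pullback (2 * p) x ∈ A.hodgePQ (2 * p) p p) →
          2 * FermatCharacter.normSum β = m * (2 * p + 2)))
    (hJ : Aoki1987_claim_juxtaposition) (hC : Aoki1987_claim_of_claim_juxtaposition_paired)
    (hP : Shioda_claim_paired) (hS : Aoki1987_claim_pStandard)
    (hDeg : ∀ (m g r : ℕ) (α' : Fin (2 * r + 2) → ZMod (m / g)) (α : Fin (2 * r + 2) → ZMod m),
      0 < g → g ∣ m → (∀ i, α' i ≠ 0) → (∀ i, α i = ((g * (α' i).val : ℕ) : ZMod m)) →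
      FermatCharacter.Claim (m / g) r α' → FermatCharacter.Claim m r α)
    (hSurf : ∀ (k : ℕ) (σ : Fin (2 * 1 + 2) → ZMod (2 ^ k)), FermatCharacter.IsHodge σ →
      FermatCharacter.Claim (2 ^ k) 1 σ) :
    Aoki1987_hodgeClasses_algebraic_fermat_primePow :=
  Aoki1987_primePow_of_claims hLef hE hJ hC hP fun _ _ hq hk a ha r σ hσ ↦
    FermatCharacter.claim_std_of_claims hS hDeg hSurf hq hk a ha r σ hσ

/-- **`HodgeConjectureFor n X` for Fermat varieties of prime-power degree from the same inputs**, plus the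
existence of Hodge models (`nonempty_hodgeModel`, the anti-vacuity conjunct) — the clause "prime powers
(Aoki1987 Cor. 2-3)" of `FermatFourfoldsHC` (route `DerivedTorelliFermat`) in the summit's spelling, through
`hodgeConjectureFor_fermat_primePow_of`. [cite: Aoki1987, Cor. 2-3 (p. 388)] [cite: Deligne2000, §1] -/
theorem hodgeConjectureFor_fermat_primePow_of_pStandard {n m : ℕ} {X : Motives.SchemeOver ℂ}
    (hLef : Voisin2003_smoothHypersurface_algebraicClasses_eq_top)
    (hE : ∀ ⦃p m : ℕ⦄, IsPrimePow m → 0 < p →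
      (∀ α : Fin (2 * p + 2) → ZMod m, α ≠ 0 → (∃ i, α i = 0) → fermatEigenspace m α (2 * p) = ⊥) ∧
      (fermatEigenspace m (0 : Fin (2 * p + 2) → ZMod m) (2 * p) ≤
        LinearMap.range (complexBetti.map (SmoothHypersurface.hypersurfaceι (fermatPolynomial ℂ (2 * p) m)) (2 * p)).hom) ∧
      (∀ (A : HodgeModel (2 * p) (fermatHypersurface (2 * p) m)) (β : Fin (2 * p + 2) → ZMod m),
        (∀ i, β i ≠ 0) →
        (∃ x ∈ fermatEigenspace m β (2 * p), x ≠ 0 ∧ A.pullback (2 * p) x ∈ A.hodgePQ (2 * p) p p) →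
          2 * FermatCharacter.normSum β = m * (2 * p + 2)))
    (hJ : Aoki1987_claim_juxtaposition) (hC : Aoki1987_claim_of_claim_juxtaposition_paired)
    (hP : Shioda_claim_paired) (hS : Aoki1987_claim_pStandard)
    (hDeg : ∀ (m g r : ℕ) (α' : Fin (2 * r + 2) → ZMod (m / g)) (α : Fin (2 * r + 2) → ZMod m),
      0 < g → g ∣ m → (∀ i, α' i ≠ 0) → (∀ i, α i = ((g * (α' i).val : ℕ) : ZMod m)) →
      FermatCharacter.Claim (m / g) r α' → FermatCharacter.Claim m r α)
    (hSurf : ∀ (k : ℕ) (σ : Fin (2 * 1 + 2) → ZMod (2 ^ k)), FermatCharacter.IsHodge σ →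
      FermatCharacter.Claim (2 ^ k) 1 σ)
    (hA : nonempty_hodgeModel n X) (hm : IsPrimePow m) (hF : Motives.IsFermatVariety n m X)
    (hX : Motives.IsSmoothProjective n X) : HodgeConjectureFor n X :=
  hodgeConjectureFor_fermat_primePow_of (Aoki1987_primePow_of_pStandard hLef hE hJ hC hP hS hDeg hSurf)
    hA hm hF hX

end Final

/-! ### Per-degree assembly: all `Xⁿₘ` for ONE degree `m`, from Lefschetz, the eigenspace inputs and the claims -/

section PerDegree

variable {m : ℕ}

/-- **The Hodge classes of every Fermat variety of a FIXED degree `m` from Lefschetz, the eigenspace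
inputs and the claims in degree `m`** — the common per-degree form of the reductions
`hodgeClasses_algebraic_fermat_of_eigenspaces` (`m` prime or `≤ 20`) and
`Aoki1987_primePow_of_eigenspaces` (prime powers): granted (L), the inputs `hE2`/`hE0`/`hE4` of
`mem_algebraicClasses_fermat_middle_of_eigenspaces` for `X²ᵖₘ` (all `p > 0`) and claim(`α`) for every
Hodge character `α` of every `X²ᵖₘ`, every rational `(p, p)`-class on every smooth projective `X` with
`IsFermatVariety n m X` is algebraic: off the middle degree by Lefschetz
(`algebraicClasses_fermat_eq_top_of_two_mul_ne`), `p = 0` by `algebraicClasses_zero`, and in the middle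
degree by transport to the standard model `V₊(Σ xᵢᵐ)` (`IsFermatVariety.isoFermatHypersurface`,
`IsOfHodgeType.map_of_iso`, `mem_algebraicClasses_map_of_iso`) and
`mem_algebraicClasses_fermat_middle_of_eigenspaces`.
[cite: Shioda1979PJA, §2 Thm. 1 and the sentence preceding it (p. 112)] [cite: Aoki1987, Cor. 2-3 (p. 388)] -/
theorem hodgeClasses_algebraic_fermat_of_claims_at [NeZero m]
    (hLef : Voisin2003_smoothHypersurface_algebraicClasses_eq_top)
    (hE : ∀ ⦃p : ℕ⦄, 0 < p →
      (∀ α : Fin (2 * p + 2) → ZMod m, α ≠ 0 → (∃ i, α i = 0) → fermatEigenspace m α (2 * p) = ⊥) ∧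
      (fermatEigenspace m (0 : Fin (2 * p + 2) → ZMod m) (2 * p) ≤
        LinearMap.range (complexBetti.map (SmoothHypersurface.hypersurfaceι (fermatPolynomial ℂ (2 * p) m)) (2 * p)).hom) ∧
      (∀ (A : HodgeModel (2 * p) (fermatHypersurface (2 * p) m)) (β : Fin (2 * p + 2) → ZMod m),
        (∀ i, β i ≠ 0) →
        (∃ x ∈ fermatEigenspace m β (2 * p), x ≠ 0 ∧ A.pullback (2 * p) x ∈ A.hodgePQ (2 * p) p p) →
          2 * FermatCharacter.normSum β = m * (2 * p + 2)))
    (hB : ∀ ⦃p : ℕ⦄, 0 < p → ∀ α : Fin (2 * p + 2) → ZMod m, FermatCharacter.IsHodge α →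
      FermatCharacter.Claim m p α)
    ⦃n : ℕ⦄ ⦃X : Motives.SchemeOver ℂ⦄ (hF : Motives.IsFermatVariety n m X)
    (hX : Motives.IsSmoothProjective n X) (p : ℕ) (c : complexBetti X (2 * p)) (hc : IsRationalClass c)
    (hpp : IsOfHodgeType n X (2 * p) p p c) : c ∈ algebraicClasses X p := by
  have hm1 : 1 ≤ m := NeZero.one_le
  by_cases hp : 2 * p = n
  · subst hp
    rcases Nat.eq_zero_or_pos p with rfl | hp0
    · rw [algebraicClasses_zero]
      exact Submodule.mem_top
    have hX' : IsSmoothProjective (2 * p) (fermatHypersurface (2 * p) m) :=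
      isSmoothProjective_fermatHypersurface (by omega) hm1
    let e : X ≅ fermatHypersurface (2 * p) m := hF.isoFermatHypersurface
    set c' : complexBetti (fermatHypersurface (2 * p) m) (2 * p) :=
      singularCohomology.map ℂ ℂ (Motives.AlgPoints.mapContinuous (L := ℂ) e.inv) (2 * p) c with hc'
    have hc'rat : IsRationalClass c' := hc.map _
    have hc'pp : IsOfHodgeType (2 * p) (fermatHypersurface (2 * p) m) (2 * p) p p c' :=
      hpp.map_of_iso e.symm
    obtain ⟨hE2, hE0, hE4⟩ := hE hp0
    have hc'alg : c' ∈ algebraicClasses (fermatHypersurface (2 * p) m) p :=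
      mem_algebraicClasses_fermat_middle_of_eigenspaces hp0 hE2 hE0 hE4 (hB hp0) c' hc'rat hc'pp
    have := mem_algebraicClasses_map_of_iso hX' hX e hc'alg
    rwa [hc', show complexBetti.map e.hom (2 * p)
        (singularCohomology.map ℂ ℂ (Motives.AlgPoints.mapContinuous (L := ℂ) e.inv) (2 * p) c) = c from
      map_hom_map_inv_apply e (2 * p) c] at this
  · rw [algebraicClasses_fermat_eq_top_of_two_mul_ne hLef hX hF hm1 hp]
    exact Submodule.mem_top

end PerDegree

/-! ### Degrees `p` and `p²`: no degree-raising and no Fermat-surface input (da Silva's Thm. 2.8) -/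

section LeTwo

namespace FermatCharacter

variable {p k : ℕ}

/-- **For `m = pᵏ` with `k ≤ 2`, Aoki's side condition `d/(⟨a⟩, d) > 2` (`d = m/p`) forces `k = 2`,
`(⟨a⟩, d) = 1`, `d = p > 2`** (for `k ≤ 1`, `d ≤ 1`; for `k = 2`, `d = p` and `(⟨a⟩, p) ∈ {1, p}`):
in degrees `p` and `p²` every standard element `σ_{p,a}` already satisfies the hypothesis
`(a, d) = 1` of Thm. 2-1, and there are none for `p = 2`.
[cite: Aoki1987, §1 p. 387 (σ_{p,i}, d/(i,d) > 2) and §2 (p. 388: (a, d) = 1)] -/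
theorem two_lt_of_le_two (hp : p.Prime) (hk2 : k ≤ 2) {a : ZMod (p ^ k)}
    (ha : 2 < (p ^ k / p) / Nat.gcd a.val (p ^ k / p)) :
    k = 2 ∧ Nat.Coprime a.val (p ^ k / p) ∧ 2 < p ^ k / p ∧ p ≠ 2 := by
  obtain rfl | rfl | rfl : k = 0 ∨ k = 1 ∨ k = 2 := by omega
  · exfalso
    have hd : p ^ 0 / p = 0 := by rw [pow_zero]; exact Nat.div_eq_of_lt hp.one_lt
    rw [hd, Nat.zero_div] at ha
    omega
  · exfalso
    have hd : p ^ 1 / p = 1 := by rw [pow_one]; exact Nat.div_self hp.pos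
    rw [hd, Nat.gcd_one_right, Nat.div_one] at ha
    omega
  · have hd : p ^ 2 / p = p := by rw [sq, Nat.mul_div_cancel_left p hp.pos]
    rw [hd] at ha ⊢
    rcases hp.eq_one_or_self_of_dvd _ (Nat.gcd_dvd_right a.val p) with hg | hg
    · rw [hg, Nat.div_one] at ha
      refine ⟨rfl, hg, ha, ?_⟩
      rintro rfl
      omega
    · rw [hg, Nat.div_self hp.pos] at ha
      omega

/-- **Claim(`α`) for every Hodge character of `X^{2r}_{pᵏ}`, `k ≤ 2`, from Thm. 1-4 (i), (ii), Thm. 1-1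
and Thm. 2-1 ALONE** (the named facts `Aoki1987_claim_juxtaposition`,
`Aoki1987_claim_of_claim_juxtaposition_paired`, `Shioda_claim_paired`, `Aoki1987_claim_pStandard`): in
degrees `p` and `p²` the standard multisets required by Thm. 1-2 (`claim_of_primePow_of_claims`) all
have `(⟨a⟩, d) = 1` and `p` odd (`two_lt_of_le_two`), so Thm. 2-1 applies to them directly — neither
the degree-raising pull-back `X_{pᵏ} → X_{pᵏ/g}` (needed from `k = 3` on: e.g. `σ_{3,3} = (3,12,21,18)`
on `X²₂₇`) nor Remark 2-2 (`p = 2`, needed from `m = 8` on) enters. This is the architecture behind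
da Silva's attribution "THEOREM 2.8 (A). If `m = p²`, the Hodge conjecture is true for `Xⁿₘ` for all
`n`". [cite: Aoki1987, Cor. 2-3 (p. 388), proof] [cite: daSilva2021HodgeFermat, Thm. 2.8 (p. 5)] -/
theorem IsHodge.claim_of_primePow_le_two_of_claims
    (hJ : Aoki1987_claim_juxtaposition) (hC : Aoki1987_claim_of_claim_juxtaposition_paired)
    (hP : Shioda_claim_paired) (hS : Aoki1987_claim_pStandard)
    (hp : p.Prime) (hk : 0 < k) (hk2 : k ≤ 2)
    {r : ℕ} {α : Fin (2 * r + 2) → ZMod (p ^ k)} (hα : IsHodge α) :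
    Claim (p ^ k) r α := by
  classical
  haveI : NeZero (p ^ k) := ⟨pow_ne_zero _ hp.ne_zero⟩
  refine hα.claim_of_primePow_of_claims hJ hC hP hp hk ?_
  intro a ha s σ hσ
  obtain ⟨-, hcop, hd, hp2⟩ := two_lt_of_le_two hp hk2 ha
  rw [if_neg hp2, add_zero] at hσ
  have hcard : p = 2 * s + 1 := by
    have h := congrArg Multiset.card hσ
    rw [card_univ_val_map, Multiset.card_add, Multiset.card_map, Multiset.card_range,
      Multiset.card_singleton] at h
    omega
  exact hS (p ^ k) p s hp hcard (dvd_pow_self p hk.ne') hd a hcop σ hσ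

end FermatCharacter

/-- **Cor. 2-3 in degrees `p` and `p²` (da Silva's Thm. 2.8) from (L), (E) and the four named facts
only**: granted Lefschetz off the middle degree, the eigenspace inputs `hE2`/`hE0`/`hE4` for the
prime-power degrees, Thm. 1-4 (i)/(ii), Thm. 1-1 and Thm. 2-1 (`Aoki1987_claim_juxtaposition`,
`Aoki1987_claim_of_claim_juxtaposition_paired`, `Shioda_claim_paired`, `Aoki1987_claim_pStandard`),
every rational `(p, p)`-class on every smooth projective Fermat variety `Xⁿ_{qᵏ}`, `q` prime,
`1 ≤ k ≤ 2`, is algebraic — WITHOUT the hypotheses `hDeg` (degree raising) and `hSurf` (Fermat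
surfaces of degree `2ᵏ`) of `Aoki1987_primePow_of_pStandard`, which only the degrees `qᵏ`, `k ≥ 3`
require. [cite: Aoki1987, Cor. 2-3 (p. 388)] [cite: daSilva2021HodgeFermat, Thm. 2.8 (p. 5)] -/
theorem Aoki1987_primePow_le_two_of_pStandard
    (hLef : Voisin2003_smoothHypersurface_algebraicClasses_eq_top)
    (hE : ∀ ⦃p m : ℕ⦄, IsPrimePow m → 0 < p →
      (∀ α : Fin (2 * p + 2) → ZMod m, α ≠ 0 → (∃ i, α i = 0) → fermatEigenspace m α (2 * p) = ⊥) ∧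
      (fermatEigenspace m (0 : Fin (2 * p + 2) → ZMod m) (2 * p) ≤
        LinearMap.range (complexBetti.map (SmoothHypersurface.hypersurfaceι (fermatPolynomial ℂ (2 * p) m)) (2 * p)).hom) ∧
      (∀ (A : HodgeModel (2 * p) (fermatHypersurface (2 * p) m)) (β : Fin (2 * p + 2) → ZMod m),
        (∀ i, β i ≠ 0) →
        (∃ x ∈ fermatEigenspace m β (2 * p), x ≠ 0 ∧ A.pullback (2 * p) x ∈ A.hodgePQ (2 * p) p p) →
          2 * FermatCharacter.normSum β = m * (2 * p + 2)))
    (hJ : Aoki1987_claim_juxtaposition) (hC : Aoki1987_claim_of_claim_juxtaposition_paired)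
    (hP : Shioda_claim_paired) (hS : Aoki1987_claim_pStandard)
    {q k : ℕ} (hq : q.Prime) (hk : 0 < k) (hk2 : k ≤ 2)
    ⦃n : ℕ⦄ ⦃X : Motives.SchemeOver ℂ⦄ (hF : Motives.IsFermatVariety n (q ^ k) X)
    (hX : Motives.IsSmoothProjective n X) (p : ℕ) (c : complexBetti X (2 * p)) (hc : IsRationalClass c)
    (hpp : IsOfHodgeType n X (2 * p) p p c) : c ∈ algebraicClasses X p := by
  haveI : NeZero (q ^ k) := ⟨pow_ne_zero _ hq.ne_zero⟩
  have hm : IsPrimePow (q ^ k) := (isPrimePow_nat_iff _).mpr ⟨q, k, hq, hk, rfl⟩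
  exact hodgeClasses_algebraic_fermat_of_claims_at hLef (fun p hp ↦ hE hm hp)
    (fun p _ α hα ↦ hα.claim_of_primePow_le_two_of_claims hJ hC hP hS hq hk hk2) hF hX p c hc hpp

/-- **`HodgeConjectureFor n X` for the Fermat varieties of degree `q` and `q²`** from the same inputs
plus the existence of Hodge models (`nonempty_hodgeModel`).
[cite: Aoki1987, Cor. 2-3 (p. 388)] [cite: daSilva2021HodgeFermat, Thm. 2.8 (p. 5)] [cite: Deligne2000, §1] -/
theorem hodgeConjectureFor_fermat_primePow_le_two_of_pStandard {n q k : ℕ} {X : Motives.SchemeOver ℂ}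
    (hLef : Voisin2003_smoothHypersurface_algebraicClasses_eq_top)
    (hE : ∀ ⦃p m : ℕ⦄, IsPrimePow m → 0 < p →
      (∀ α : Fin (2 * p + 2) → ZMod m, α ≠ 0 → (∃ i, α i = 0) → fermatEigenspace m α (2 * p) = ⊥) ∧
      (fermatEigenspace m (0 : Fin (2 * p + 2) → ZMod m) (2 * p) ≤
        LinearMap.range (complexBetti.map (SmoothHypersurface.hypersurfaceι (fermatPolynomial ℂ (2 * p) m)) (2 * p)).hom) ∧
      (∀ (A : HodgeModel (2 * p) (fermatHypersurface (2 * p) m)) (β : Fin (2 * p + 2) → ZMod m),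
        (∀ i, β i ≠ 0) →
        (∃ x ∈ fermatEigenspace m β (2 * p), x ≠ 0 ∧ A.pullback (2 * p) x ∈ A.hodgePQ (2 * p) p p) →
          2 * FermatCharacter.normSum β = m * (2 * p + 2)))
    (hJ : Aoki1987_claim_juxtaposition) (hC : Aoki1987_claim_of_claim_juxtaposition_paired)
    (hP : Shioda_claim_paired) (hS : Aoki1987_claim_pStandard)
    (hA : nonempty_hodgeModel n X) (hq : q.Prime) (hk : 0 < k) (hk2 : k ≤ 2)
    (hF : Motives.IsFermatVariety n (q ^ k) X) (hX : Motives.IsSmoothProjective n X) :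
    HodgeConjectureFor n X :=
  ⟨hA hX, fun p c hc hpp ↦
    Aoki1987_primePow_le_two_of_pStandard hLef hE hJ hC hP hS hq hk hk2 hF hX p c hc hpp⟩

end LeTwo

/-! ### Feeding the inputs the tree supplies: (L) discharged, (F) from Aoki–Shioda 1983 `(2.1)` -/

section Inputs

/-- **(F) from the tree's named fact.** Claim for every Hodge character of the Fermat surface `X²_{2ᵏ}`
(the hypothesis `hSurf` of `claim_std_of_claims` / `Aoki1987_primePow_of_pStandard`, Remark 2-2) is the
degree-`2ᵏ` case of `AokiShioda1983_eigenline_le_neronSeveri` ("`NS(X²ₘ) ⊗ ℂ ⊇ V(α)` for every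
`α ∈ 𝔅²ₘ`", which is `claim(α)` at `r = 1` by `Iff.rfl`). [cite: AokiShioda1983, §2 (2.1)–(2.2), p. 3]
[cite: Aoki1987, Rem. 2-2 (p. 388)] -/
theorem claim_surface_two_pow_of_neronSeveri (hNS : AokiShioda1983_eigenline_le_neronSeveri) (k : ℕ)
    (σ : Fin (2 * 1 + 2) → ZMod (2 ^ k)) (hσ : FermatCharacter.IsHodge σ) :
    FermatCharacter.Claim (2 ^ k) 1 σ :=
  hNS (2 ^ k) σ hσ

/-- **Cor. 2-3 assembled, III: the fact from the eigenspace inputs (E), the named facts of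
`FermatInductiveClaims` (Thm. 1-4 (i), (ii), Thm. 1-1, Thm. 2-1), the degree-raising pull-back (D) and
the named fact `AokiShioda1983_eigenline_le_neronSeveri` (F)** — `Aoki1987_primePow_of_pStandard` with
Lefschetz off the middle degree DISCHARGED (`Voisin2003_smoothHypersurface_algebraicClasses_eq_top_holds`)
and the Fermat-surface input taken from the tree's named fact. These are the exact residual obligations
of `Aoki1987_hodgeClasses_algebraic_fermat_primePow` as of this file: two explicit hypotheses ((E), (D))
and five named facts. [cite: Aoki1987, Cor. 2-3 (p. 388)] [cite: AokiShioda1983, §2 (2.1), p. 3]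
[cite: VoisinHodgeII2003, §1.2.2 Thm. 1.23 and §1.2.3 Cor. 1.24–1.25] -/
theorem Aoki1987_primePow_of_inputs
    (hE : ∀ ⦃p m : ℕ⦄, IsPrimePow m → 0 < p →
      (∀ α : Fin (2 * p + 2) → ZMod m, α ≠ 0 → (∃ i, α i = 0) → fermatEigenspace m α (2 * p) = ⊥) ∧
      (fermatEigenspace m (0 : Fin (2 * p + 2) → ZMod m) (2 * p) ≤
        LinearMap.range (complexBetti.map (SmoothHypersurface.hypersurfaceι (fermatPolynomial ℂ (2 * p) m)) (2 * p)).hom) ∧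
      (∀ (A : HodgeModel (2 * p) (fermatHypersurface (2 * p) m)) (β : Fin (2 * p + 2) → ZMod m),
        (∀ i, β i ≠ 0) →
        (∃ x ∈ fermatEigenspace m β (2 * p), x ≠ 0 ∧ A.pullback (2 * p) x ∈ A.hodgePQ (2 * p) p p) →
          2 * FermatCharacter.normSum β = m * (2 * p + 2)))
    (hJ : Aoki1987_claim_juxtaposition) (hC : Aoki1987_claim_of_claim_juxtaposition_paired)
    (hP : Shioda_claim_paired) (hS : Aoki1987_claim_pStandard)
    (hDeg : ∀ (m g r : ℕ) (α' : Fin (2 * r + 2) → ZMod (m / g)) (α : Fin (2 * r + 2) → ZMod m),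
      0 < g → g ∣ m → (∀ i, α' i ≠ 0) → (∀ i, α i = ((g * (α' i).val : ℕ) : ZMod m)) →
      FermatCharacter.Claim (m / g) r α' → FermatCharacter.Claim m r α)
    (hNS : AokiShioda1983_eigenline_le_neronSeveri) :
    Aoki1987_hodgeClasses_algebraic_fermat_primePow :=
  Aoki1987_primePow_of_pStandard Voisin2003_smoothHypersurface_algebraicClasses_eq_top_holds hE hJ hC hP
    hS hDeg (claim_surface_two_pow_of_neronSeveri hNS)

/-- **`HodgeConjectureFor n X` for Fermat varieties of prime-power degree from the same residual inputs**
plus the existence of Hodge models (`nonempty_hodgeModel`). [cite: Aoki1987, Cor. 2-3 (p. 388)]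
[cite: Deligne2000, §1] -/
theorem hodgeConjectureFor_fermat_primePow_of_inputs {n m : ℕ} {X : Motives.SchemeOver ℂ}
    (hE : ∀ ⦃p m : ℕ⦄, IsPrimePow m → 0 < p →
      (∀ α : Fin (2 * p + 2) → ZMod m, α ≠ 0 → (∃ i, α i = 0) → fermatEigenspace m α (2 * p) = ⊥) ∧
      (fermatEigenspace m (0 : Fin (2 * p + 2) → ZMod m) (2 * p) ≤
        LinearMap.range (complexBetti.map (SmoothHypersurface.hypersurfaceι (fermatPolynomial ℂ (2 * p) m)) (2 * p)).hom) ∧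
      (∀ (A : HodgeModel (2 * p) (fermatHypersurface (2 * p) m)) (β : Fin (2 * p + 2) → ZMod m),
        (∀ i, β i ≠ 0) →
        (∃ x ∈ fermatEigenspace m β (2 * p), x ≠ 0 ∧ A.pullback (2 * p) x ∈ A.hodgePQ (2 * p) p p) →
          2 * FermatCharacter.normSum β = m * (2 * p + 2)))
    (hJ : Aoki1987_claim_juxtaposition) (hC : Aoki1987_claim_of_claim_juxtaposition_paired)
    (hP : Shioda_claim_paired) (hS : Aoki1987_claim_pStandard)
    (hDeg : ∀ (m g r : ℕ) (α' : Fin (2 * r + 2) → ZMod (m / g)) (α : Fin (2 * r + 2) → ZMod m),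
      0 < g → g ∣ m → (∀ i, α' i ≠ 0) → (∀ i, α i = ((g * (α' i).val : ℕ) : ZMod m)) →
      FermatCharacter.Claim (m / g) r α' → FermatCharacter.Claim m r α)
    (hNS : AokiShioda1983_eigenline_le_neronSeveri)
    (hA : nonempty_hodgeModel n X) (hm : IsPrimePow m) (hF : Motives.IsFermatVariety n m X)
    (hX : Motives.IsSmoothProjective n X) : HodgeConjectureFor n X :=
  hodgeConjectureFor_fermat_primePow_of (Aoki1987_primePow_of_inputs hE hJ hC hP hS hDeg hNS) hA hm hF hX

/-- **The per-degree assembly with Lefschetz discharged**: for a fixed degree `m ≥ 1`, the eigenspace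
inputs for the `X²ᵖₘ` and claim for their Hodge characters give the Hodge classes of every smooth
projective `Xⁿₘ` (`hodgeClasses_algebraic_fermat_of_claims_at` fed
`Voisin2003_smoothHypersurface_algebraicClasses_eq_top_holds`).
[cite: Shioda1979PJA, §2 Thm. 1 and the sentence preceding it (p. 112)] [cite: Aoki1987, Cor. 2-3 (p. 388)] -/
theorem hodgeClasses_algebraic_fermat_of_claims_at' {m : ℕ} [NeZero m]
    (hE : ∀ ⦃p : ℕ⦄, 0 < p →
      (∀ α : Fin (2 * p + 2) → ZMod m, α ≠ 0 → (∃ i, α i = 0) → fermatEigenspace m α (2 * p) = ⊥) ∧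
      (fermatEigenspace m (0 : Fin (2 * p + 2) → ZMod m) (2 * p) ≤
        LinearMap.range (complexBetti.map (SmoothHypersurface.hypersurfaceι (fermatPolynomial ℂ (2 * p) m)) (2 * p)).hom) ∧
      (∀ (A : HodgeModel (2 * p) (fermatHypersurface (2 * p) m)) (β : Fin (2 * p + 2) → ZMod m),
        (∀ i, β i ≠ 0) →
        (∃ x ∈ fermatEigenspace m β (2 * p), x ≠ 0 ∧ A.pullback (2 * p) x ∈ A.hodgePQ (2 * p) p p) →
          2 * FermatCharacter.normSum β = m * (2 * p + 2)))
    (hB : ∀ ⦃p : ℕ⦄, 0 < p → ∀ α : Fin (2 * p + 2) → ZMod m, FermatCharacter.IsHodge α →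
      FermatCharacter.Claim m p α)
    ⦃n : ℕ⦄ ⦃X : Motives.SchemeOver ℂ⦄ (hF : Motives.IsFermatVariety n m X)
    (hX : Motives.IsSmoothProjective n X) (p : ℕ) (c : complexBetti X (2 * p)) (hc : IsRationalClass c)
    (hpp : IsOfHodgeType n X (2 * p) p p c) : c ∈ algebraicClasses X p :=
  hodgeClasses_algebraic_fermat_of_claims_at Voisin2003_smoothHypersurface_algebraicClasses_eq_top_holds
    hE hB hF hX p c hc hpp

/-- **Degrees `p` and `p²` from (E) and the four named facts of `FermatInductiveClaims` ONLY**
(`Aoki1987_primePow_le_two_of_pStandard` with Lefschetz discharged): da Silva's Thm. 2.8 then rests on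
the eigenspace inputs and Thm. 1-4 (i)/(ii), Thm. 1-1, Thm. 2-1 — no degree raising, no Fermat-surface
input, no Lefschetz hypothesis. [cite: Aoki1987, Cor. 2-3 (p. 388)] [cite: daSilva2021HodgeFermat, Thm. 2.8 (p. 5)] -/
theorem Aoki1987_primePow_le_two_of_claimFacts
    (hE : ∀ ⦃p m : ℕ⦄, IsPrimePow m → 0 < p →
      (∀ α : Fin (2 * p + 2) → ZMod m, α ≠ 0 → (∃ i, α i = 0) → fermatEigenspace m α (2 * p) = ⊥) ∧
      (fermatEigenspace m (0 : Fin (2 * p + 2) → ZMod m) (2 * p) ≤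
        LinearMap.range (complexBetti.map (SmoothHypersurface.hypersurfaceι (fermatPolynomial ℂ (2 * p) m)) (2 * p)).hom) ∧
      (∀ (A : HodgeModel (2 * p) (fermatHypersurface (2 * p) m)) (β : Fin (2 * p + 2) → ZMod m),
        (∀ i, β i ≠ 0) →
        (∃ x ∈ fermatEigenspace m β (2 * p), x ≠ 0 ∧ A.pullback (2 * p) x ∈ A.hodgePQ (2 * p) p p) →
          2 * FermatCharacter.normSum β = m * (2 * p + 2)))
    (hJ : Aoki1987_claim_juxtaposition) (hC : Aoki1987_claim_of_claim_juxtaposition_paired)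
    (hP : Shioda_claim_paired) (hS : Aoki1987_claim_pStandard)
    {q k : ℕ} (hq : q.Prime) (hk : 0 < k) (hk2 : k ≤ 2)
    ⦃n : ℕ⦄ ⦃X : Motives.SchemeOver ℂ⦄ (hF : Motives.IsFermatVariety n (q ^ k) X)
    (hX : Motives.IsSmoothProjective n X) (p : ℕ) (c : complexBetti X (2 * p)) (hc : IsRationalClass c)
    (hpp : IsOfHodgeType n X (2 * p) p p c) : c ∈ algebraicClasses X p :=
  Aoki1987_primePow_le_two_of_pStandard Voisin2003_smoothHypersurface_algebraicClasses_eq_top_holds hE hJ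
    hC hP hS hq hk hk2 hF hX p c hc hpp

/-- **`HodgeConjectureFor n X` in degrees `q` and `q²`** from (E), the four named facts of
`FermatInductiveClaims` and the existence of Hodge models. [cite: Aoki1987, Cor. 2-3 (p. 388)]
[cite: daSilva2021HodgeFermat, Thm. 2.8 (p. 5)] [cite: Deligne2000, §1] -/
theorem hodgeConjectureFor_fermat_primePow_le_two_of_claimFacts {n q k : ℕ} {X : Motives.SchemeOver ℂ}
    (hE : ∀ ⦃p m : ℕ⦄, IsPrimePow m → 0 < p →
      (∀ α : Fin (2 * p + 2) → ZMod m, α ≠ 0 → (∃ i, α i = 0) → fermatEigenspace m α (2 * p) = ⊥) ∧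
      (fermatEigenspace m (0 : Fin (2 * p + 2) → ZMod m) (2 * p) ≤
        LinearMap.range (complexBetti.map (SmoothHypersurface.hypersurfaceι (fermatPolynomial ℂ (2 * p) m)) (2 * p)).hom) ∧
      (∀ (A : HodgeModel (2 * p) (fermatHypersurface (2 * p) m)) (β : Fin (2 * p + 2) → ZMod m),
        (∀ i, β i ≠ 0) →
        (∃ x ∈ fermatEigenspace m β (2 * p), x ≠ 0 ∧ A.pullback (2 * p) x ∈ A.hodgePQ (2 * p) p p) →
          2 * FermatCharacter.normSum β = m * (2 * p + 2)))
    (hJ : Aoki1987_claim_juxtaposition) (hC : Aoki1987_claim_of_claim_juxtaposition_paired)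
    (hP : Shioda_claim_paired) (hS : Aoki1987_claim_pStandard)
    (hA : nonempty_hodgeModel n X) (hq : q.Prime) (hk : 0 < k) (hk2 : k ≤ 2)
    (hF : Motives.IsFermatVariety n (q ^ k) X) (hX : Motives.IsSmoothProjective n X) :
    HodgeConjectureFor n X :=
  ⟨hA hX, fun p c hc hpp ↦ Aoki1987_primePow_le_two_of_claimFacts hE hJ hC hP hS hq hk hk2 hF hX p c hc hpp⟩

end Inputs

end Literature.AlgebraicGeometry.HodgeTheory

end
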